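import Summits.QuantumFields.YangMills.Theorems.AtomicCalibrationRBandPiece
import Summits.QuantumFields.YangMills.Theorems.AtomicCalibrationRGridPartition

/-!
# AtomicCalibrationR (stmt-QuantumFields-28169), E2 `stub_offDiagonalWhitney` — clause (v) for band pieces, uniform `M/ρ^m` form
# (construction (T) of the E2 roadmap v2, item B.1; prover w4 g22, free hands)

`AtomicCalibrationRBandPiece.norm_iteratedFDeriv_bandPiece_le` bounds `‖D^m P(z)‖` for a band piece `P = G·(pairCut (k+1) − pairCut k)·g`
with a point-dependent decay factor `(1+‖z‖)^{−k'}`.  When `g` is the grid bump of the cube `(h, c)` the piece lives in the cube,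
where `1 + ‖z‖ ≥ (1 + ‖centre‖)/2`; off the cube all derivatives vanish.  Hence the `z`-UNIFORM form required by `WhitneyPkg` (v):

* `one_add_norm_centre_le` — on the cube, `1 + ‖centre‖ ≤ 2(1 + ‖z‖)` (`2h ≤ 1/2`);
* `norm_iteratedFDeriv_bandPiece_uniform_le` —
  `‖D^m P(z)‖ ≤ [2^M 4^{k'} ‖F‖_M (1+‖centre‖)^{−k'} (1 + 2^{−k}R)^m 2^{−kK} (2hR)^m] / (2h)^m` for all `z`
  (`M = max k' K`, `m < K`, `R ≥ 2^{k+2}` a rate of the bump part at every point).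

No stub/crux/rung/summit is closed; nothing here touches Yang–Mills; the YM mass gap is NOT proved. [folklore]
-/

set_option autoImplicit false

noncomputable section

open scoped BigOperators ContDiff
open Set Metric Function
open Summit.QuantumFields.YangMills.Cruxes.AtomicCalibrationR.PairCutoff (pairCut)
open Summit.QuantumFields.YangMills.Cruxes.AtomicCalibrationR.GridPartition (gridBump gridCentre tsupport_gridBump_subset)
open Summit.QuantumFields.YangMills.Cruxes.AtomicCalibrationR.BandPiece (norm_iteratedFDeriv_bandPiece_le)
open Literature.MathematicalPhysics.QuantumLattice (schwartzNorm schwartzNorm_nonneg)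
open Literature.MathematicalPhysics.AQFT (IsOffDiagonal)

namespace Summit.QuantumFields.YangMills.Cruxes.AtomicCalibrationR.PieceUniform

variable {n : ℕ}

/-- On the cube `{∀ l, ‖z_l − centre_l‖ ≤ 2h}` with `0 < 2h ≤ 1/2`: `1 + ‖centre‖ ≤ 2 (1 + ‖z‖)`. -/
theorem one_add_norm_centre_le {h : ℝ} (hh : 0 < h) (hh2 : 2 * h ≤ 1 / 2) (c : Fin n × Fin 4 → ℤ)
    {z : Fin n → EuclideanSpace ℝ (Fin 4)} (hz : ∀ l, ‖z l - gridCentre n h c l‖ ≤ 2 * h) :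
    1 + ‖gridCentre n h c‖ ≤ 2 * (1 + ‖z‖) := by
  have hsup : ‖z - gridCentre n h c‖ ≤ 2 * h :=
    (pi_norm_le_iff_of_nonneg (by linarith : (0 : ℝ) ≤ 2 * h)).2 fun l => hz l
  have h1 : ‖gridCentre n h c‖ ≤ ‖z‖ + 2 * h := by
    have := norm_sub_norm_le (gridCentre n h c) z
    rw [norm_sub_rev] at this
    linarith
  linarith [norm_nonneg z]

/-- **Clause (v), uniform form, band pieces.**  See the module docstring. [folklore] -/
theorem norm_iteratedFDeriv_bandPiece_uniform_le (F : SchwartzMap (Fin n → EuclideanSpace ℝ (Fin 4)) ℂ) (hF : IsOffDiagonal F)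
    {G : (Fin n → EuclideanSpace ℝ (Fin 4)) → ℝ} (hG : ContDiff ℝ ∞ G)
    (hGF : ∀ (j : ℕ) (w : Fin n → EuclideanSpace ℝ (Fin 4)), ‖iteratedFDeriv ℝ j G w‖ ≤ ‖iteratedFDeriv ℝ j F w‖)
    {φ : ℝ → ℝ} (hφ : ContDiff ℝ ∞ φ) (hφs : tsupport φ ⊆ Icc (-1 : ℝ) 1) {h : ℝ} (hh : 0 < h) (hh2 : 2 * h ≤ 1 / 2)
    (c : Fin n × Fin 4 → ℤ) (k : ℕ) {K m k' : ℕ} (hmK : m < K) {R : ℝ} (hR : (2 : ℝ) ^ (k + 2) ≤ R)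
    (hb : ∀ (z : Fin n → EuclideanSpace ℝ (Fin 4)) (i : ℕ), i ≤ m →
      ‖iteratedFDeriv ℝ i (fun w => (pairCut n (k + 1) w - pairCut n k w) * gridBump φ n h c w) z‖ ≤ R ^ i)
    (z : Fin n → EuclideanSpace ℝ (Fin 4)) :
    ‖iteratedFDeriv ℝ m (fun w => G w * ((pairCut n (k + 1) w - pairCut n k w) * gridBump φ n h c w)) z‖ ≤
      (2 ^ max k' K * 4 ^ k' * schwartzNorm (max k' K) F / (1 + ‖gridCentre n h c‖) ^ k' *
        (1 + (2 : ℝ)⁻¹ ^ k * R) ^ m * ((2 : ℝ)⁻¹ ^ k) ^ K * (2 * h * R) ^ m) / (2 * h) ^ m := by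
  have hRpos : 0 < R := lt_of_lt_of_le (by positivity) hR
  have hS : 0 ≤ schwartzNorm (max k' K) F := schwartzNorm_nonneg _ _
  have h2h : 0 < 2 * h := by linarith
  -- the right-hand side is non-negative
  have hRHS : 0 ≤ (2 ^ max k' K * 4 ^ k' * schwartzNorm (max k' K) F / (1 + ‖gridCentre n h c‖) ^ k' *
        (1 + (2 : ℝ)⁻¹ ^ k * R) ^ m * ((2 : ℝ)⁻¹ ^ k) ^ K * (2 * h * R) ^ m) / (2 * h) ^ m := by positivity
  by_cases hz : z ∈ tsupport (fun w => G w * ((pairCut n (k + 1) w - pairCut n k w) * gridBump φ n h c w))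
  · -- on the cube: compare the decay factors
    have hcube : ∀ l, ‖z l - gridCentre n h c l‖ ≤ 2 * h := by
      have hsub : tsupport (fun w => G w * ((pairCut n (k + 1) w - pairCut n k w) * gridBump φ n h c w)) ⊆
          tsupport (gridBump φ n h c) :=
        (tsupport_mul_subset_right
          (f := fun w => G w) (g := fun w => (pairCut n (k + 1) w - pairCut n k w) * gridBump φ n h c w)).trans
          (tsupport_mul_subset_right (f := fun w => pairCut n (k + 1) w - pairCut n k w) (g := gridBump φ n h c))
      exact tsupport_gridBump_subset hφs n hh c (hsub hz)
    have hcmp := one_add_norm_centre_le hh hh2 c hcube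
    have h1 := norm_iteratedFDeriv_bandPiece_le F hF hG hGF
      (Summit.QuantumFields.YangMills.Cruxes.AtomicCalibrationR.GridPartition.contDiff_gridBump hφ n h c) k (k' := k') hmK hR z (hb z)
    refine h1.trans ?_
    -- `1/(1+‖z‖)^{k'} ≤ 2^{k'}/(1+‖centre‖)^{k'}` and `R^m = (2hR)^m/(2h)^m`
    have hdec : 2 ^ max k' K * 2 ^ k' * schwartzNorm (max k' K) F / (1 + ‖z‖) ^ k' ≤
        2 ^ max k' K * 4 ^ k' * schwartzNorm (max k' K) F / (1 + ‖gridCentre n h c‖) ^ k' := by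
      rw [div_le_div_iff₀ (by positivity) (by positivity)]
      have hpow : (1 + ‖gridCentre n h c‖) ^ k' ≤ 2 ^ k' * (1 + ‖z‖) ^ k' := by
        rw [← mul_pow]; exact pow_le_pow_left₀ (by positivity) hcmp k'
      have h4 : (4 : ℝ) ^ k' = 2 ^ k' * 2 ^ k' := by rw [← mul_pow]; norm_num
      calc 2 ^ max k' K * 2 ^ k' * schwartzNorm (max k' K) F * (1 + ‖gridCentre n h c‖) ^ k'
          ≤ 2 ^ max k' K * 2 ^ k' * schwartzNorm (max k' K) F * (2 ^ k' * (1 + ‖z‖) ^ k') :=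
            mul_le_mul_of_nonneg_left hpow (by positivity)
        _ = 2 ^ max k' K * 4 ^ k' * schwartzNorm (max k' K) F * (1 + ‖z‖) ^ k' := by rw [h4]; ring
    have hRm : R ^ m = (2 * h * R) ^ m / (2 * h) ^ m := by
      rw [mul_pow, mul_comm, mul_div_assoc, div_self (pow_ne_zero _ h2h.ne'), mul_one]
    rw [hRm]
    have hmid : 0 ≤ (1 + (2 : ℝ)⁻¹ ^ k * R) ^ m * ((2 : ℝ)⁻¹ ^ k) ^ K := by positivity
    calc 2 ^ max k' K * 2 ^ k' * schwartzNorm (max k' K) F / (1 + ‖z‖) ^ k' * (1 + (2 : ℝ)⁻¹ ^ k * R) ^ m *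
          ((2 : ℝ)⁻¹ ^ k) ^ K * ((2 * h * R) ^ m / (2 * h) ^ m)
        ≤ 2 ^ max k' K * 4 ^ k' * schwartzNorm (max k' K) F / (1 + ‖gridCentre n h c‖) ^ k' *
          (1 + (2 : ℝ)⁻¹ ^ k * R) ^ m * ((2 : ℝ)⁻¹ ^ k) ^ K * ((2 * h * R) ^ m / (2 * h) ^ m) := by
          have hq : 0 ≤ (2 * h * R) ^ m / (2 * h) ^ m := by positivity
          have := mul_le_mul_of_nonneg_right (mul_le_mul_of_nonneg_right hdec hmid) hq
          calc _ = 2 ^ max k' K * 2 ^ k' * schwartzNorm (max k' K) F / (1 + ‖z‖) ^ k' *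
                ((1 + (2 : ℝ)⁻¹ ^ k * R) ^ m * ((2 : ℝ)⁻¹ ^ k) ^ K) * ((2 * h * R) ^ m / (2 * h) ^ m) := by ring
            _ ≤ 2 ^ max k' K * 4 ^ k' * schwartzNorm (max k' K) F / (1 + ‖gridCentre n h c‖) ^ k' *
                ((1 + (2 : ℝ)⁻¹ ^ k * R) ^ m * ((2 : ℝ)⁻¹ ^ k) ^ K) * ((2 * h * R) ^ m / (2 * h) ^ m) := this
            _ = _ := by ring
      _ = _ := by ring
  · -- off the support every derivative vanishes
    have h0 : iteratedFDeriv ℝ m (fun w => G w * ((pairCut n (k + 1) w - pairCut n k w) * gridBump φ n h c w)) z = 0 := by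
      by_contra hne
      exact hz (support_iteratedFDeriv_subset m (mem_support.2 hne))
    rw [h0, norm_zero]
    exact hRHS

end Summit.QuantumFields.YangMills.Cruxes.AtomicCalibrationR.PieceUniform

end
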